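import Summits.QuantumAdvantage.AdviceFreeQNC0.FibreDecimation37NHFibre
import HarnessLib

/-!
# Cell qa-qnc0, `p = 3` — ROUND-37P2 File B: **Theorem 37.F′ (`FibreNonExact37NH`) for `m ≥ 3`**, and the failure of the
# typed statement at `m = 1`

Planner qa-qnc0-p2 g37, ROUND-37P2 §2 Theorem 37.F′ ("heavy-code form — the version to use"), typed verbatim as
`Exp37.FibreNonExact37NH` in `FibreDecimation37.lean` (ported by qn-prover-3 g23): on the parity coset `H_ε ⊂ {0,1}^z` the
parity `f` of the MOD-3 tests `[⟨β_k,u⟩ ≢ r_k]` agrees with ANY `𝔽₂`-affine target on at most `(1 − 2^{−m−3})·2^{z−1}` points,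
provided the dense test `k₀` carries the nowhere-zero pattern `a` on the `m` chosen coins (`m` odd) and the decimated code
satisfies (NH).

* **`fibreNonExact37NH_of_three_le`** — the theorem for every odd `m ≥ 3` (all other data verbatim).  Proof = ROUND-37P2 §2:
  STEP 1 (`|B''| ≤ |D|`: an even outside assignment `y` above which some point of `H_ε` disagrees injects into the
  disagreement set), STEP 2 (`good_fibre_parity`: above a good `y` the fibre function vanishes on `H_ε(M)`, so Lemma 37.D
  — `decimation_identity` — yields the decoded parity relation `#{k : ⟨β_k|_Y,y⟩ ∈ Acc_k} ≡ c⋆`), STEP 3′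
  (`card_parityClass_filter_le`: that relation holds for at most `(7/8)·2^{|Y|−1}` even `y`, by Parseval/Cauchy–Schwarz under
  (NH), the tests off `J` being trivial and `k₀` genuine by Lemma 37.D (ii)); hence `|D| ≥ 2^{|Y|−1}/8 = 2^{−m−3}·2^{z−1}`.
* The typed `FibreNonExact37NH` itself (which also quantifies over `m = 1`) is NOT claimed, and is in fact FALSE at
  `m = 1`: there Lemma 37.D (ii) fails (`B_{k₀} ≠ 0`: with `M = {i}` the direction `−δ_{k₀} + e_i` is `a`-compatible),
  and the statement has a counterexample — on `H_ε` the bit `u_{c₀}` of the single chosen coin is a function of the outside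
  bits `y`, so `t_{k₀}|_{H_ε}` is a Boolean function of `y`; and EVERY Boolean function of `y` is a parity of MOD-3 tests not
  touching `c₀` (for `γ₁,…,γ_k` and a point `p ∈ 𝔽₃^k`, the sum of the indicators of the affine hyperplanes of `𝔽₃^k`
  through `p` is `δ_p` or `1 + δ_p (mod 2)` according to the parities of `(3^k−1)/2`, `(3^{k−1}−1)/2`; take `γ_c = e_c`),
  while such blind tests never enter `J`, so (NH) holds with `J = {k₀}` for a dense `β_{k₀}` and `z ≥ 18`.  The first `m`
  for which the decimation method works is `m = 3`; the planner's intended values are `m = 13, 15` (ROUND-37P2 §2), so the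
  intended content of Theorem 37.F′ is exactly `fibreNonExact37NH_of_three_le`.  (The typed target should carry `3 ≤ m`.)

WHAT THIS IS NOT: `FibreNonExact37` (constant targets under the `L¹` hypothesis (Gen_d)), `FibreNonExact37NHS` (§3.8 mixed
populations) and Corollary 37.C are not attempted here; crux 22907 (`RingDenseResidualLt3`) untouched; no separation claim.
-/

noncomputable section

namespace Summit.QuantumAdvantage.AdviceFreeQNC0.Exp37

open Finset
open Summit.QuantumAdvantage.AdviceFreeQNC0 F4
open Literature.Computability.MetaComplexity.ModTestProduct

/-- **Theorem 37.F′ (ROUND-37P2 §2) for odd `m ≥ 3` — PROVED.**  Under (NH), with the dense test `k₀` reading the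
nowhere-zero pattern `a` on the `m` chosen coins, every `𝔽₂`-affine target is missed on at least a `2^{−(m+3)}` fraction
of the parity coset: `#{u ∈ H_ε : f(u) ≡ λ(u)} ≤ (1 − 2^{−m−3})·2^{z−1}`. -/
theorem fibreNonExact37NH_of_three_le (z s m : ℕ) (ι : Fin m ↪ Fin z) (β : Fin s → Fin z → ZMod 3)
    (r : Fin s → ZMod 3) (k₀ : Fin s) (a : Fin m → Bool) (hm : Odd m) (h3 : 3 ≤ m) (hz : 1 ≤ z - m)
    (hβ : ∀ i, β k₀ (ι i) = lettZ (a i)) (hNH : NHCond ι a β) (ε μ₀ : ℕ) (S : Finset (Fin z)) :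
    (((coset z ε).filter fun u => testParity β r u % 2 = affTarget μ₀ S u % 2).card : ℝ)
      ≤ (1 - (2 : ℝ)⁻¹ ^ (m + 3)) * (2 : ℝ) ^ (z - 1) := by
  classical
  -- the coset, its agreement and disagreement parts
  set agree : (Fin z → Bool) → Prop := fun u => testParity β r u % 2 = affTarget μ₀ S u % 2 with hagree
  have hHcard : ((coset z ε).card : ℝ) = (2 : ℝ) ^ (z - 1) := by
    have h := card_parityClass (ι := Fin z) (by rw [Fintype.card_fin]; omega) ε
    rw [Fintype.card_fin] at h
    exact h
  have hsplitH := card_filter_add_card_filter_not (s := coset z ε) agree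
  set D : Finset (Fin z → Bool) := (coset z ε).filter fun u => ¬ agree u with hD
  -- the outside cube and its even half
  have hn : Fintype.card (Out ι) = z - m := card_out ι
  have hnpos : 0 < Fintype.card (Out ι) := by rw [hn]; exact hz
  set Yev : Finset (Out ι → Bool) := univ.filter fun y => (univ.filter fun c => y c = true).card % 2 = 0 % 2 with hYev
  have hYcard : (Yev.card : ℝ) = (2 : ℝ) ^ (z - m - 1) := by
    rw [← hn]; exact card_parityClass hnpos 0
  -- STEP 1: even `y` above which some point of the coset disagrees inject into `D`
  set res : (Fin z → Bool) → (Out ι → Bool) := fun u c => u c.1 with hres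
  set Bset : Finset (Out ι → Bool) := Yev.filter fun y => ∃ u ∈ D, res u = y with hBset
  set Good : Finset (Out ι → Bool) := Yev.filter fun y => ¬ ∃ u ∈ D, res u = y with hGood
  have hsplitY := card_filter_add_card_filter_not (s := Yev) (fun y => ∃ u ∈ D, res u = y)
  have hBD : Bset.card ≤ D.card := by
    refine Finset.card_le_card_of_injOn
      (fun y => if h : ∃ u ∈ D, res u = y then h.choose else fun _ => false) (fun y hy => ?_) ?_
    · obtain ⟨-, h⟩ := mem_filter.1 hy
      simp only [dif_pos h]
      exact h.choose_spec.1
    · intro y hy y' hy' heq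
      obtain ⟨-, h⟩ := mem_filter.1 (mem_coe.1 hy)
      obtain ⟨-, h'⟩ := mem_filter.1 (mem_coe.1 hy')
      simp only [dif_pos h, dif_pos h'] at heq
      calc y = res h.choose := h.choose_spec.2.symm
        _ = res h'.choose := by rw [heq]
        _ = y' := h'.choose_spec.2
  -- STEP 2 + 3′: good `y` satisfy the decoded parity relation, which holds for few `y`
  have hGoodP : Good ⊆ univ.filter fun y : Out ι → Bool =>
      (univ.filter fun c => y c = true).card % 2 = 0 % 2 ∧
        (univ.filter fun k => subsetSum (dirOut ι β k) y ∈ accSet ι β r a ε k).card % 2 = cStar ι a ε S % 2 := by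
    intro y hy
    obtain ⟨hyev, hgood⟩ := mem_filter.1 hy
    obtain ⟨-, hy0⟩ := mem_filter.1 hyev
    refine mem_filter.2 ⟨mem_univ _, hy0, ?_⟩
    refine good_fibre_parity ι β r a μ₀ ε S hm y (by omega) fun u hu hres' => ?_
    by_contra hne
    exact hgood ⟨u, mem_filter.2 ⟨hu, hne⟩, hres'⟩
  obtain ⟨hk₀, hk₀'⟩ := accSet_pattern_genuine ι β r a ε hm (by omega) k₀ hβ
  have hP := card_parityClass_filter_le (dirOut ι β) (accSet ι β r a ε) (decimSet ι a β)
    (accSet_eq_empty_of_not_mem_decimSet ι β r a ε hm) k₀ hk₀ hk₀' hnpos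
    (nh_weight_sum_le ι a β hNH _ fun j => by simp only [mem_filter, mem_univ, true_and]) 0 (cStar ι a ε S)
  rw [hn] at hP
  have hGoodNat : Good.card ≤ _ := card_le_card hGoodP
  have hGood : (Good.card : ℝ) ≤ 7 / 8 * (2 : ℝ) ^ (z - m - 1) := (Nat.cast_le.2 hGoodNat).trans hP
  -- assembly
  have hsplitHR : (((coset z ε).filter agree).card : ℝ) + (D.card : ℝ) = (2 : ℝ) ^ (z - 1) := by
    rw [← hHcard]; exact_mod_cast hsplitH
  have hsplitYR : (Bset.card : ℝ) + (Good.card : ℝ) = (2 : ℝ) ^ (z - m - 1) := by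
    rw [← hYcard]; exact_mod_cast hsplitY
  have hBDR : (Bset.card : ℝ) ≤ (D.card : ℝ) := by exact_mod_cast hBD
  have hpow : (2 : ℝ) ^ (z - 1) = (2 : ℝ) ^ m * (2 : ℝ) ^ (z - m - 1) := by
    rw [← pow_add]; congr 1; omega
  have hinv : (2 : ℝ)⁻¹ ^ (m + 3) * ((2 : ℝ) ^ m * (2 : ℝ) ^ (z - m - 1)) = (2 : ℝ) ^ (z - m - 1) / 8 := by
    obtain ⟨X, hX⟩ : ∃ X : ℝ, X = (2 : ℝ)⁻¹ ^ (m + 3) := ⟨_, rfl⟩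
    have h1 : X * (2 : ℝ) ^ (m + 3) = 1 := by
      rw [hX, ← mul_pow]; norm_num
    have h28 : (2 : ℝ) ^ (m + 3) = (2 : ℝ) ^ m * 8 := by rw [pow_add]; norm_num
    rw [h28] at h1
    rw [← hX]
    calc X * ((2 : ℝ) ^ m * (2 : ℝ) ^ (z - m - 1)) = X * ((2 : ℝ) ^ m * 8) * (2 : ℝ) ^ (z - m - 1) / 8 := by ring
      _ = (2 : ℝ) ^ (z - m - 1) / 8 := by rw [h1, one_mul]
  rw [show (((coset z ε).filter fun u => testParity β r u % 2 = affTarget μ₀ S u % 2).card : ℝ) =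
      (((coset z ε).filter agree).card : ℝ) from rfl]
  rw [hpow, sub_mul, one_mul, hinv]
  linarith

end Summit.QuantumAdvantage.AdviceFreeQNC0.Exp37

end
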